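import Summits.QuantumFields.BalabanUV.Beta.GAN24.TableDressingZeroMode
import Summits.QuantumFields.BalabanUV.Beta.GAN24.CoarseGaugeSourceResponse

/-!
# `BalabanUV.Beta.GAN24.SawtoothSlotCalculus` — binder row G-an2-4 ∕ (CONV-C), row (C) at the levels `j ≥ 1`, CONTACT side; the tools of Part 9
# `GAN24/BackgroundPairSectorWardForm` of `GAN24/FourFaceGaugeSectors` (my g64 memo `C-CONTACT-SECTORS-v0.md` §7 (b)(c); leaf-06 g52's memo
# `C-LEVELS-GE1.md` §18 «the sawtooth-weight junction (finite `Tset` → bounded periodic `λ` by `LocStencil₂` locality; mine∕leaf-02)»): **THE BLOCK SAWTOOTH ON A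
# TABLE SLOT** — its forward difference is the pure-gauge sector weight `1 − N·[m % N = N−1]`; summation by parts in ONE coordinate turns that weight on a
# lattice-summed slot into the sawtooth against an2's slot divergence `KernelWard.divV`; and THE CELL–SLOT EXCHANGE: for a jointly `N`-periodic two-slot
# function it does not matter which slot runs over one cell and which over the lattice

NOT IN PRINT; OUR BOOKKEEPING (G-an2-4 crux team (2), leaf prover `b2b-balaban-gan24-formalise-leaf-02`, gen 65; journal [LEAF02-G65-ONLINE] ∕ INTENT
I-leaf02-g65-1).  WHY.  Part 1 (`FourFaceGaugeSectors`, p367201 ✓) expands the comb member's four-face excess — the CONTACT side of p2's one-step charge law —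
in pure-gauge sectors; the background-pair sector carries the gradient of the block sawtooth `λ_κ(w) = w_κ % N` on BOTH background slots, one summed over a
cell, one over the lattice.  It is valued by an2's PER-SITE `hS₂` law (`WardLocusQuarticSite.siteLaw_T2RecAt_succ`, p366760 ✓; weighted form for FINITELY
supported weights on a finite `Tset` of divergence sites).  A naive summation by parts would put the PERIODIC sawtooth — infinite support — on the divergence
site (memo §7 (c) proposed a box-exhaustion limit).  The limit is unnecessary: the two slots can be EXCHANGED (§3), the summation by parts done on the
lattice-summed slot (§2), and a second exchange puts the sawtooth on the CELL-summed divergence site with the finite weight `(y₀)_κ` — Part 9 assembles this;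
THIS FILE holds the slot calculus it needs, generic and reusable (the leg-pair sector and leaf-06's L1′ junction meet the same three moves).

WHAT (generic `d`; `Y : Tab d` with `LocStencil₂ Y C δ`, `0 < δ`, and — where said — the ff-COVARIANCE `Y κ (u+t) κ′ (u′+t) x z (inl α) (inl β) = shiftK (−t)
(Y κ u κ′ u′) x z (inl α) (inl β)` for ALL unit translations `t` (Part 1's `h1`); [folklore] integer arithmetic of `· % N`, lattice re-indexing, summation by
parts, Fubini on absolutely convergent sums; 0 `def`, 0 cited facts, 0 `def … : Prop`, 0 sorry):
* §1 `int_emod_succ_sub` ∕ **`saw_succ_sub`** (`λ(m+1) − λ(m) = 1 − N·[m % N = N−1]`: the forward difference of the block sawtooth IS the sector's slot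
  weight), `saw_nonneg`, `saw_lt`, `abs_saw_le`, `abs_sawGrad_le`, `emod_add_zsmul_apply` (`N`-periodicity of both weights along `N•ℤ^{d+1}`),
  `toSite_emod_of_mem_box` (inside the cell the sawtooth is the coordinate).
* §2 **`tsum_sawGrad_mul_eq_tsum_saw_mul_div`** — SUMMATION BY PARTS IN ONE COORDINATE: for slot-summable columns `c μ`,
  `Σ'_y (1 − N·[y_κ % N = N−1])·c κ y = Σ'_y λ(y_κ)·Σ_μ (c μ (y − e_μ) − c μ y)` (an2's `KernelWard.divV` orientation; over my
  `CoarseGaugeSourceResponse.tsum_mul_coarseDiv_eq`: the `μ ≠ κ` components of `dλ_κ` vanish).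
* §3 **`sum_box_tsum_exchange`** — THE CELL–SLOT EXCHANGE: for `F : Site → Site → ℝ` with `F (u + N•t) (v + N•t) = F u v` and summable sections,
  `Σ_{r∈box N} Σ'_v F (toSite r) v = Σ_{v₀∈box N} Σ'_u F u (toSite v₀)` (`BiStencilZeroMode.tsum_eq_sum_box_tsum` on both sides + `t ↦ −t`).
* §4 `summable_triple_fst` (a `LocStencil₂` slice is absolutely summable in (FIRST bond, both legs) at fixed second bond — shear `(u,x,z) ↦ (u,x−u,z−u)`),
  `summable_legSum_snd ∕ _fst` (the leg double sum is summable in either bond).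
* §5 `tsum_tsum_shiftK`, **`legSum_translate`** (the ff leg double sum is jointly unit-invariant in the two bonds), **`legSum_divV_eq`** (the leg double sum of
  the first-slot divergence `= Σ_μ (Q_μ(y₀ − e_μ, v) − Q_μ(y₀, v))`), `legSum_divV_translate`, `summable_legSum_divV_snd ∕ _fst`.
HONEST FRAMING (cell contract, verbatim): «discharging `BetaPertH` makes Bałaban's UV stability UNCONDITIONAL — a real constructive-QFT result; it is NOT the
continuum limit and NOT the Clay problem.»  HONEST DEPENDENCY (verbatim): «continuum YM on T⁴ ⇐ BetaPertH ∧ nine spine estimates (0/9 proved); BetaPertH ⇐ (D1)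
∧ (D4) ∧ CAP+tail; G-an2-4 gates asym, D1 and NE2/3/4.»  Bookkeeping only: NO Ward content, NO estimate of Bałaban's; discharges NOTHING of (C) ∕ (C)sym ∕
(Q-L) ∕ «T2Shape» ∕ «T2Drift» ∕ (hW, hWall); 0 wall binders; NEVER «G-an2-4 closed» as (CONV-C); NOT D1, NOT BetaPertH, NOT continuum, NOT Clay.  2026-08-23.
-/

noncomputable section

open Finset
open scoped BigOperators
open Literature.MathematicalPhysics.QuantumFieldTheory
open Literature.MathematicalPhysics.QuantumFieldTheory.Balaban1983to89
open Literature.MathematicalPhysics.QuantumFieldTheory.Balaban1983to89.Beta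
open B12Sec2to5 (l1 l1_nonneg)
open B6BondElimination (unitVec unitVec_apply)
open ExpKernelCalculus (MKer BiLoc shiftK comp summable_exp_shift' l1_sub_symm)
open KernelWard (divV)
open AffineAveraging (Site box toSite)
open OneStepResolventKernel (Fib)
open BalabanCompositeJets (LocStencil₂)
open Summit.QuantumFields.BalabanUV.Beta.GAN24.BiStencilZeroMode (Tab zmode tsum_eq_sum_box_tsum)
open Summit.QuantumFields.BalabanUV.Beta.GAN24.KernelLegCharges (summable_prod_of_biLoc)
open Summit.QuantumFields.BalabanUV.Beta.GAN24.TableDressingZeroMode (summable_triple summable_legs)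
open Summit.QuantumFields.BalabanUV.Beta.GAN24.CoarseGaugeSourceResponse (summable_bdd_mul tsum_mul_coarseDiv_eq)
open Summit.QuantumFields.BalabanUV.Beta.GAN24.SymLinKernelFaceSupport (int_ediv_add_one)

namespace Summit.QuantumFields.BalabanUV.Beta.GAN24.SawtoothSlotCalculus

variable {d : ℕ} {N : ℕ}

/-! ## §1 The block sawtooth `λ(m) = m % N` and its gradient `1 − N·[m % N = N−1]`: one-coordinate arithmetic -/

/-- [folklore] **THE FORWARD DIFFERENCE OF THE BLOCK SAWTOOTH** (integers, `1 ≤ N`): `(m+1) % N − m % N = 1 − N·[m % N = N−1]`. -/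
theorem int_emod_succ_sub (hN : 1 ≤ N) (m : ℤ) :
    (m + 1) % (N : ℤ) - m % (N : ℤ) = 1 - (N : ℤ) * (if m % (N : ℤ) = (N : ℤ) - 1 then 1 else 0) := by
  have e1 := Int.emod_def (m + 1) (N : ℤ)
  have e2 := Int.emod_def m (N : ℤ)
  have e3 := int_ediv_add_one hN m
  linear_combination e1 - e2 - (N : ℤ) * e3

/-- [folklore] The same over `ℝ`: `λ(m+1) − λ(m) = 1 − N·[m % N = N−1]` — the forward difference of the block sawtooth IS the sector's slot weight. -/
theorem saw_succ_sub (hN : 1 ≤ N) (m : ℤ) :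
    (((m + 1) % (N : ℤ) : ℤ) : ℝ) - ((m % (N : ℤ) : ℤ) : ℝ) = 1 - (N : ℝ) * (if m % (N : ℤ) = (N : ℤ) - 1 then (1 : ℝ) else 0) := by
  have h := congrArg (fun z : ℤ => (z : ℝ)) (int_emod_succ_sub hN m)
  simp only [Int.cast_sub, Int.cast_one, Int.cast_mul, Int.cast_natCast, Int.cast_ite, Int.cast_zero] at h
  exact h

/-- [folklore] `0 ≤ λ(m)`. -/
theorem saw_nonneg (hN : 1 ≤ N) (m : ℤ) : (0 : ℝ) ≤ ((m % (N : ℤ) : ℤ) : ℝ) := by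
  have hN0 : (N : ℤ) ≠ 0 := by exact_mod_cast Nat.one_le_iff_ne_zero.mp hN
  exact_mod_cast Int.emod_nonneg m hN0

/-- [folklore] `λ(m) < N`. -/
theorem saw_lt (hN : 1 ≤ N) (m : ℤ) : ((m % (N : ℤ) : ℤ) : ℝ) < N := by
  have hN0 : (0 : ℤ) < N := by exact_mod_cast hN
  exact_mod_cast Int.emod_lt_of_pos m hN0

/-- [folklore] `|λ(m)| ≤ N`. -/
theorem abs_saw_le (hN : 1 ≤ N) (m : ℤ) : |((m % (N : ℤ) : ℤ) : ℝ)| ≤ N := by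
  rw [abs_of_nonneg (saw_nonneg hN m)]
  exact (saw_lt hN m).le

/-- [folklore] `|1 − N·[m % N = N−1]| ≤ N + 1`. -/
theorem abs_sawGrad_le (N : ℕ) (m : ℤ) : |1 - (N : ℝ) * (if m % (N : ℤ) = (N : ℤ) - 1 then (1 : ℝ) else 0)| ≤ N + 1 := by
  have hN : (0 : ℝ) ≤ N := Nat.cast_nonneg N
  split_ifs
  · rw [mul_one]
    exact abs_le.mpr ⟨by linarith, by linarith⟩
  · rw [mul_zero, sub_zero, abs_one]
    linarith

/-- [folklore] Both weights are `N`-periodic along the lattice: `(v + N•t)_κ % N = v_κ % N`. -/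
theorem emod_add_zsmul_apply (N : ℕ) (v t : Site (d + 1)) (κ : Fin (d + 1)) :
    (v + (N : ℤ) • t) κ % (N : ℤ) = v κ % (N : ℤ) := by
  simp only [Pi.add_apply, Pi.smul_apply, smul_eq_mul]
  exact Int.add_mul_emod_self_left _ _ _

/-- [folklore] Inside the cell the sawtooth is the coordinate: `(toSite y₀)_κ % N = (y₀)_κ` for `y₀ ∈ box N`. -/
theorem toSite_emod_of_mem_box {y₀ : Fin (d + 1) → ℕ} (hy : y₀ ∈ box (d + 1) N) (κ : Fin (d + 1)) :
    toSite y₀ κ % (N : ℤ) = (y₀ κ : ℤ) := by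
  have hlt : y₀ κ < N := by
    have h := (Fintype.mem_piFinset.mp hy) κ
    exact Finset.mem_range.mp h
  simp only [AffineAveraging.toSite]
  exact Int.emod_eq_of_lt (by exact_mod_cast Nat.zero_le _) (by exact_mod_cast hlt)

/-! ## §2 Summation by parts in one coordinate: the sawtooth gradient on a slot is the sawtooth against the slot divergence -/

/-- NOT IN PRINT; OUR BOOKKEEPING.  **SUMMATION BY PARTS IN ONE COORDINATE** (slot-summable columns `c μ`, `1 ≤ N`, direction `κ`):
`Σ'_y (1 − N·[y_κ % N = N−1])·c κ y = Σ'_y λ(y_κ)·Σ_μ (c μ (y − e_μ) − c μ y)` — the weight `λ_κ(y) = y_κ % N` has `(dλ_κ)_μ = 0` for `μ ≠ κ` and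
`(dλ_κ)_κ(y) = 1 − N·[y_κ % N = N−1]` (§1), so pairing the pure gauge `dλ_κ` with the one-form `c` and summing by parts (`tsum_mul_coarseDiv_eq`) gives an2's
divergence orientation `Σ_μ (c μ (y − e_μ) − c μ y)` (`KernelWard.divV`). -/
theorem tsum_sawGrad_mul_eq_tsum_saw_mul_div (hN : 1 ≤ N) (c : Fin (d + 1) → Site (d + 1) → ℝ) (hc : ∀ μ, Summable (c μ))
    (κ : Fin (d + 1)) :
    ∑' y : Site (d + 1), (1 - (N : ℝ) * (if y κ % (N : ℤ) = (N : ℤ) - 1 then (1 : ℝ) else 0)) * c κ y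
      = ∑' y : Site (d + 1), (((y κ % (N : ℤ)) : ℤ) : ℝ) * ∑ μ, (c μ (y - unitVec μ) - c μ y) := by
  rw [tsum_mul_coarseDiv_eq c hc (fun y : Site (d + 1) => (((y κ % (N : ℤ)) : ℤ) : ℝ)) (fun y => abs_saw_le hN (y κ)),
    Finset.sum_eq_single_of_mem κ (Finset.mem_univ κ)]
  · refine tsum_congr fun y => ?_
    have e : (y + unitVec κ) κ = y κ + 1 := by simp [unitVec_apply]
    rw [e, saw_succ_sub hN]
  · intro μ _ hμ
    have e : ∀ y : Site (d + 1), (y + unitVec μ) κ = y κ := fun y => by simp [unitVec_apply, Ne.symm hμ]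
    simp_rw [e, sub_self, zero_mul, tsum_zero]

/-! ## §3 The cell–slot exchange -/

/-- NOT IN PRINT; OUR BOOKKEEPING.  **THE CELL–SLOT EXCHANGE**: for a jointly `N`-periodic two-slot function (`F (u + N•t) (v + N•t) = F u v`) with summable
sections, it does not matter WHICH slot runs over one cell and which over the lattice: `Σ_{r∈box N} Σ'_v F (toSite r) v = Σ_{v₀∈box N} Σ'_u F u (toSite v₀)`
(cell decomposition of both lattice sums, `BiStencilZeroMode.tsum_eq_sum_box_tsum`, and `t ↦ −t` in the coset variable). -/
theorem sum_box_tsum_exchange [NeZero N] (F : Site (d + 1) → Site (d + 1) → ℝ)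
    (hF : ∀ u v t : Site (d + 1), F (u + (N : ℤ) • t) (v + (N : ℤ) • t) = F u v)
    (h1 : ∀ rr ∈ box (d + 1) N, Summable fun v => F (toSite rr) v)
    (h2 : ∀ vv ∈ box (d + 1) N, Summable fun u => F u (toSite vv)) :
    ∑ rr ∈ box (d + 1) N, ∑' v : Site (d + 1), F (toSite rr) v = ∑ vv ∈ box (d + 1) N, ∑' u : Site (d + 1), F u (toSite vv) := by
  rw [Finset.sum_congr rfl fun rr hrr => tsum_eq_sum_box_tsum (N := N) (h1 rr hrr),
    Finset.sum_congr rfl fun vv hvv => tsum_eq_sum_box_tsum (N := N) (h2 vv hvv), Finset.sum_comm]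
  refine Finset.sum_congr rfl fun vv _ => Finset.sum_congr rfl fun rr _ => ?_
  rw [← (Equiv.neg (Site (d + 1))).tsum_eq (fun t : Site (d + 1) => F ((N : ℤ) • t + toSite rr) (toSite vv))]
  refine tsum_congr fun t => ?_
  have h := hF (toSite rr + (N : ℤ) • (-t)) (toSite vv) t
  rw [smul_neg, neg_add_cancel_right] at h
  rw [Equiv.neg_apply, smul_neg, add_comm ((N : ℤ) • t) (toSite vv), h, add_comm (toSite rr)]

/-! ## §4 Summability of the slices of a `LocStencil₂` table in either slot -/

/-- [folklore] **A `LocStencil₂` TABLE IS ABSOLUTELY SUMMABLE IN (FIRST BOND, FIRST LEG, SECOND LEG) JOINTLY AT FIXED SECOND BOND** (rate `δ > 0`; dominated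
by `C·e^{−δ|u−u′|}·e^{−δ|x−u|}·e^{−δ|z−u|}`, a product after the shear `(u,x,z) ↦ (u, x−u, z−u)`). -/
theorem summable_triple_fst {Y : Tab d} {C δ : ℝ} (hY : LocStencil₂ Y C δ) (hδ : 0 < δ) (κ κ' : Fin (d + 1)) (u' : Site (d + 1))
    (a b : Fib d) :
    Summable fun p : Site (d + 1) × (Site (d + 1) × Site (d + 1)) => Y κ p.1 κ' u' p.2.1 p.2.2 a b := by
  have h1 : Summable fun u : Site (d + 1) => Real.exp (-δ * l1 (u - u')) := summable_exp_shift' hδ u'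
  have h0 : Summable fun x : Site (d + 1) => Real.exp (-δ * l1 x) :=
    (summable_exp_shift' hδ (0 : Site (d + 1))).congr fun x => by rw [sub_zero]
  have h23 : Summable fun xz : Site (d + 1) × Site (d + 1) => Real.exp (-δ * l1 xz.1) * Real.exp (-δ * l1 xz.2) :=
    h0.mul_of_nonneg h0 (fun _ => (Real.exp_pos _).le) (fun _ => (Real.exp_pos _).le)
  have hP : Summable fun p : Site (d + 1) × (Site (d + 1) × Site (d + 1)) =>
      Real.exp (-δ * l1 (p.1 - u')) * (Real.exp (-δ * l1 p.2.1) * Real.exp (-δ * l1 p.2.2)) :=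
    h1.mul_of_nonneg h23 (fun _ => (Real.exp_pos _).le) (fun _ => mul_nonneg (Real.exp_pos _).le (Real.exp_pos _).le)
  -- the shear `(u, x, z) ↦ (u, x − u, z − u)` is injective
  set e : Site (d + 1) × (Site (d + 1) × Site (d + 1)) → Site (d + 1) × (Site (d + 1) × Site (d + 1)) :=
    fun p => (p.1, (p.2.1 - p.1, p.2.2 - p.1)) with he
  have hinj : Function.Injective e := by
    rintro ⟨u, x, z⟩ ⟨u₁, x₁, z₁⟩ h
    simp only [he, Prod.mk.injEq] at h
    obtain ⟨rfl, hx, hz⟩ := h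
    rw [sub_left_inj] at hx hz
    rw [hx, hz]
  have hQ := hP.comp_injective hinj
  refine Summable.of_norm_bounded (hQ.mul_left C) fun p => ?_
  rw [Real.norm_eq_abs]
  calc |Y κ p.1 κ' u' p.2.1 p.2.2 a b|
      ≤ C * Real.exp (-δ * l1 (u' - p.1)) * Real.exp (-δ * (l1 (p.2.1 - p.1) + l1 (p.2.2 - p.1))) := hY κ p.1 κ' u' p.2.1 p.2.2 a b
    _ = C * (Real.exp (-δ * l1 (p.1 - u')) * (Real.exp (-δ * l1 (p.2.1 - p.1)) * Real.exp (-δ * l1 (p.2.2 - p.1)))) := by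
        rw [l1_sub_symm u' p.1, mul_add, Real.exp_add]; ring
    _ = C * ((fun q : Site (d + 1) × (Site (d + 1) × Site (d + 1)) =>
          Real.exp (-δ * l1 (q.1 - u')) * (Real.exp (-δ * l1 q.2.1) * Real.exp (-δ * l1 q.2.2))) ∘ e) p := by
        simp only [Function.comp, he]

/-- [folklore] The leg double sum of a slice is summable in the SECOND bond (`summable_triple`, Fubini). -/
theorem summable_legSum_snd {Y : Tab d} {C δ : ℝ} (hY : LocStencil₂ Y C δ) (hδ : 0 < δ) (κ : Fin (d + 1)) (u : Site (d + 1))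
    (κ' : Fin (d + 1)) (a b : Fib d) :
    Summable fun u' : Site (d + 1) => ∑' x : Site (d + 1), ∑' z : Site (d + 1), Y κ u κ' u' x z a b := by
  have h3 := summable_triple hY hδ κ u κ' a b
  exact h3.prod.congr fun u' => (h3.prod_factor u').tsum_prod

/-- [folklore] The leg double sum of a slice is summable in the FIRST bond (`summable_triple_fst`, Fubini). -/
theorem summable_legSum_fst {Y : Tab d} {C δ : ℝ} (hY : LocStencil₂ Y C δ) (hδ : 0 < δ) (κ κ' : Fin (d + 1)) (u' : Site (d + 1))
    (a b : Fib d) :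
    Summable fun u : Site (d + 1) => ∑' x : Site (d + 1), ∑' z : Site (d + 1), Y κ u κ' u' x z a b := by
  have h3 := summable_triple_fst hY hδ κ κ' u' a b
  exact h3.prod.congr fun u => (h3.prod_factor u).tsum_prod

/-! ## §5 The leg double sum: unit invariance, the divergence's leg double sum -/

/-- [folklore] A simultaneous shift of both legs does not change the leg double sum (two re-indexings, no summability). -/
theorem tsum_tsum_shiftK (w : Site (d + 1)) (K : MKer (d + 1) (Fib d)) (a b : Fib d) :
    ∑' x : Site (d + 1), ∑' z : Site (d + 1), shiftK w K x z a b = ∑' x : Site (d + 1), ∑' z : Site (d + 1), K x z a b := by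
  have inner : ∀ x' : Site (d + 1), ∑' z : Site (d + 1), K x' (z + w) a b = ∑' z : Site (d + 1), K x' z a b := by
    intro x'
    rw [← (Equiv.addRight w).tsum_eq (fun z : Site (d + 1) => K x' z a b)]
    simp only [Equiv.coe_addRight]
  simp only [shiftK]
  simp_rw [inner]
  rw [← (Equiv.addRight w).tsum_eq (fun x : Site (d + 1) => ∑' z : Site (d + 1), K x z a b)]
  simp only [Equiv.coe_addRight]

/-- [folklore] **THE FIELD–FIELD LEG DOUBLE SUM IS JOINTLY UNIT-INVARIANT IN THE TWO BONDS** (ff block unit-covariant):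
`Σ'_{xz} Y κ (u+t) κ′ (u′+t) x z (inl α)(inl β) = Σ'_{xz} Y κ u κ′ u′ x z (inl α)(inl β)`. -/
theorem legSum_translate {Y : Tab d}
    (h1 : ∀ κ u κ' u' (t x z : Site (d + 1)) (α β : Fin (d + 1)),
      Y κ (u + t) κ' (u' + t) x z (Sum.inl α) (Sum.inl β) = shiftK (-t) (Y κ u κ' u') x z (Sum.inl α) (Sum.inl β))
    (κ : Fin (d + 1)) (u : Site (d + 1)) (κ' : Fin (d + 1)) (u' t : Site (d + 1)) (α β : Fin (d + 1)) :
    (∑' x : Site (d + 1), ∑' z : Site (d + 1), Y κ (u + t) κ' (u' + t) x z (Sum.inl α) (Sum.inl β))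
      = ∑' x : Site (d + 1), ∑' z : Site (d + 1), Y κ u κ' u' x z (Sum.inl α) (Sum.inl β) := by
  simp_rw [h1 κ u κ' u' t]
  exact tsum_tsum_shiftK (-t) (Y κ u κ' u') _ _

/-- [folklore] **THE LEG DOUBLE SUM OF THE FIRST-SLOT DIVERGENCE** (second slot `(κ′, v)` passive; `LocStencil₂`, any legs):
`Σ'_{xz} divV (fun μ y ↦ Y μ y κ′ v) y₀ x z a b = Σ_μ (Σ'_{xz} Y μ (y₀ − e_μ) κ′ v x z a b − Σ'_{xz} Y μ y₀ κ′ v x z a b)`. -/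
theorem legSum_divV_eq {Y : Tab d} {C δ : ℝ} (hY : LocStencil₂ Y C δ) (hδ : 0 < δ) (κ' : Fin (d + 1)) (v y₀ : Site (d + 1)) (a b : Fib d) :
    (∑' x : Site (d + 1), ∑' z : Site (d + 1), divV (fun μ y => Y μ y κ' v) y₀ x z a b)
      = ∑ μ : Fin (d + 1), ((∑' x : Site (d + 1), ∑' z : Site (d + 1), Y μ (y₀ - unitVec μ) κ' v x z a b)
          - ∑' x : Site (d + 1), ∑' z : Site (d + 1), Y μ y₀ κ' v x z a b) := by
  have ept : ∀ x z : Site (d + 1), divV (fun μ y => Y μ y κ' v) y₀ x z a b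
      = ∑ μ : Fin (d + 1), (Y μ (y₀ - unitVec μ) κ' v x z a b - Y μ y₀ κ' v x z a b) := by
    intro x z
    simp only [divV, Finset.sum_apply, Pi.sub_apply]
  simp_rw [ept]
  -- product summability of every piece
  have hA : ∀ μ, Summable fun q : Site (d + 1) × Site (d + 1) => Y μ (y₀ - unitVec μ) κ' v q.1 q.2 a b :=
    fun μ => summable_legs hY hδ μ (y₀ - unitVec μ) κ' v a b
  have hB : ∀ μ, Summable fun q : Site (d + 1) × Site (d + 1) => Y μ y₀ κ' v q.1 q.2 a b :=
    fun μ => summable_legs hY hδ μ y₀ κ' v a b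
  have hS : Summable fun q : Site (d + 1) × Site (d + 1) =>
      ∑ μ : Fin (d + 1), (Y μ (y₀ - unitVec μ) κ' v q.1 q.2 a b - Y μ y₀ κ' v q.1 q.2 a b) :=
    summable_sum fun μ _ => (hA μ).sub (hB μ)
  calc ∑' x : Site (d + 1), ∑' z : Site (d + 1), ∑ μ : Fin (d + 1), (Y μ (y₀ - unitVec μ) κ' v x z a b - Y μ y₀ κ' v x z a b)
      = ∑' q : Site (d + 1) × Site (d + 1), ∑ μ : Fin (d + 1), (Y μ (y₀ - unitVec μ) κ' v q.1 q.2 a b - Y μ y₀ κ' v q.1 q.2 a b) :=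
        hS.tsum_prod.symm
    _ = ∑ μ : Fin (d + 1), ∑' q : Site (d + 1) × Site (d + 1), (Y μ (y₀ - unitVec μ) κ' v q.1 q.2 a b - Y μ y₀ κ' v q.1 q.2 a b) :=
        Summable.tsum_finsetSum (fun μ _ => (hA μ).sub (hB μ))
    _ = ∑ μ : Fin (d + 1), ((∑' q : Site (d + 1) × Site (d + 1), Y μ (y₀ - unitVec μ) κ' v q.1 q.2 a b)
          - ∑' q : Site (d + 1) × Site (d + 1), Y μ y₀ κ' v q.1 q.2 a b) :=
        Finset.sum_congr rfl fun μ _ => (hA μ).tsum_sub (hB μ)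
    _ = _ := Finset.sum_congr rfl fun μ _ => by rw [(hA μ).tsum_prod, (hB μ).tsum_prod]

/-- [folklore] The divergence's leg double sum is jointly unit-invariant in (divergence site, passive bond). -/
theorem legSum_divV_translate {Y : Tab d} {C δ : ℝ} (hY : LocStencil₂ Y C δ) (hδ : 0 < δ)
    (h1 : ∀ κ u κ' u' (t x z : Site (d + 1)) (α β : Fin (d + 1)),
      Y κ (u + t) κ' (u' + t) x z (Sum.inl α) (Sum.inl β) = shiftK (-t) (Y κ u κ' u') x z (Sum.inl α) (Sum.inl β))
    (κ' : Fin (d + 1)) (v y₀ t : Site (d + 1)) (α β : Fin (d + 1)) :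
    (∑' x : Site (d + 1), ∑' z : Site (d + 1), divV (fun μ y => Y μ y κ' (v + t)) (y₀ + t) x z (Sum.inl α) (Sum.inl β))
      = ∑' x : Site (d + 1), ∑' z : Site (d + 1), divV (fun μ y => Y μ y κ' v) y₀ x z (Sum.inl α) (Sum.inl β) := by
  rw [legSum_divV_eq hY hδ κ' (v + t) (y₀ + t), legSum_divV_eq hY hδ κ' v y₀]
  refine Finset.sum_congr rfl fun μ _ => ?_
  rw [show y₀ + t - unitVec μ = (y₀ - unitVec μ) + t from by abel, legSum_translate h1, legSum_translate h1]

/-- [folklore] The divergence's leg double sum is summable in the passive bond. -/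
theorem summable_legSum_divV_snd {Y : Tab d} {C δ : ℝ} (hY : LocStencil₂ Y C δ) (hδ : 0 < δ) (κ' : Fin (d + 1)) (y₀ : Site (d + 1))
    (a b : Fib d) :
    Summable fun v : Site (d + 1) => ∑' x : Site (d + 1), ∑' z : Site (d + 1), divV (fun μ y => Y μ y κ' v) y₀ x z a b := by
  simp_rw [legSum_divV_eq hY hδ κ' _ y₀]
  exact summable_sum fun μ _ => (summable_legSum_snd hY hδ μ (y₀ - unitVec μ) κ' a b).sub (summable_legSum_snd hY hδ μ y₀ κ' a b)

/-- [folklore] The divergence's leg double sum is summable in the divergence site. -/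
theorem summable_legSum_divV_fst {Y : Tab d} {C δ : ℝ} (hY : LocStencil₂ Y C δ) (hδ : 0 < δ) (κ' : Fin (d + 1)) (v : Site (d + 1))
    (a b : Fib d) :
    Summable fun y₀ : Site (d + 1) => ∑' x : Site (d + 1), ∑' z : Site (d + 1), divV (fun μ y => Y μ y κ' v) y₀ x z a b := by
  simp_rw [legSum_divV_eq hY hδ κ' v]
  refine summable_sum fun μ _ => Summable.sub ?_ (summable_legSum_fst hY hδ μ κ' v a b)
  exact (Equiv.subRight (unitVec μ)).summable_iff.mpr (summable_legSum_fst hY hδ μ κ' v a b)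

end Summit.QuantumFields.BalabanUV.Beta.GAN24.SawtoothSlotCalculus

end
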